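import Literature.MathematicalPhysics.QuantumLattice.HubbardTTPrimeTPPDoublingUAnchors
import Literature.MathematicalPhysics.QuantumLattice.DWaveSourceEnergyDensityTPPTransport
import HarnessLib

/-!
# The `U`-dressed third-neighbour (`t''`) law at EVERY filling: the unconstrained and the pair-sourced
# (grand-canonical) object-M densities

Topic `Literature/MathematicalPhysics/QuantumLattice` (family `hubbard`). Companion of
`HubbardTTPrimeTPPDoublingUAnchors` (the law at fixed filling `0 < ρ < 2`: the doubling map `x ↦ 2x` reads the pure-`t''`
Hubbard interaction WITH its repulsion as the nearest-neighbour one) and of the kinematic all-fillings rows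
`HubbardTTPrimeKinematicRowsAllFillings` / the sourced seam `DWaveSourceEnergyDensityTPPTransport` §3 (object-M
pair-sourced energy within `(16/π²)|t''|` of object E). Consumers work with infima over ALL translation-invariant
states (the `μ`-form `tiGroundEnergyDensity` of `TppSeam.lean`, the sourced floor of `TppSeamOrder(Filling).lean`),
so the dressed bracket is restated with an ALL-FILLINGS `t' = 0` row `ℓ ≤ 0`, `ℓ ≤ e(1, 0, V, ρ)` for every
`0 < ρ < 2` (the extreme fillings `ρ ∈ {0, 2}` carry no hopping and double occupancy `0`, `1`):

* §1 `IsTranslationInvariant.abs_mul_le_tpp_add_of_allFillings` — `|s|ℓ ≤ s·K₃(σ) + |s|V·D(σ)` for EVERY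
  translation-invariant `σ`; `…_mem_Icc_…` the two-sided bracket; `allFillingsRow_of_tangent` — an all-density
  tangent `a + bρ ≤ e(1,0,V,ρ)` with `b ≥ 0`, `a ≤ 0` gives `ℓ = a`.
* §2 `tiGroundEnergyDensity_add_abs_mul_le_tpp` — the UNCONSTRAINED object-M floor
  `e₀^{tt'}(t, t', U − |s|V) + |s|ℓ ≤ e₀(t, t', s, U)` (range parameters `1` / `2`).
* §3 `dWaveSourceEnergyDensityTT'_add_abs_mul_le_tppSourced` — the PAIR-SOURCED object-M floor at every source:
  `e_src(t', U − |s|V, μ, h) + |s|ℓ ≤ e^M_src(t', s, U, μ, h)`; fed form replacing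
  `tiGroundEnergyDensity_tppSourced_ge_of_le`'s `lo − (16/π²)|t''|` by `lo' + |t''|ℓ` with `lo'` a sourced floor read
  `|t''|V` lower in `U` (the sourced density is non-decreasing in `U`, so a floor certified at any `U₀ ≤ U − |t''|V` serves).

Everything is PROVED; no definition, no named fact, no number, no `sorry`. HONEST SCOPE: zeroth-order energy
bookkeeping for the `t''` truncation; `ℓ` from all-density tangent families (e.g. at `V = 8` the `(8, ½, 0)` tangent,
slope `> 0`, gives `ℓ ≈ −1.32` vs `−16/π² = −1.62`); nothing here is an order / pairing / `T_c` statement by itself.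

## Mathlib / tree search

REUSED: `meanEnergy_hubbardTT'T''_eq_add_mapAct_doubling`, `meanEnergy_mapAct_doubling`,
`IsTranslationInvariant.abs_mul_energyDensityTT'_nn_le_tpp_add` (`HubbardTTPrimeTPPDoublingUAnchors`);
`hubbardTTPrimeFermionInteraction_tPrime_zero`, `IsTranslationInvariant.hubbardEnergyDensity_eq_zero_of_density_eq_zero /
_eq_of_density_eq_two`; `meanEnergy_hubbardTT'T''Sourced`, `meanEnergy_hubbardTTPrimeSourced`,
`dWaveSourceEnergyDensityTT'_eq_tiGroundEnergyDensity[_two]`; `FermionInteraction.le_tiGroundEnergyDensity /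
tiGroundEnergyDensity_le_meanEnergy`. `lean search 'allFillings.*tpp|tppSourced.*diagU'` (2026-08-28): nothing.

## References

* E. Pavarini et al., PRL 87 (2001) 047003, eq. (1). [cite: PavariniEtAl2001, eq. (1)]
* D. Ruelle, *Statistical Mechanics: Rigorous Results* (1969), §3.4. [cite: Ruelle1969, §3.4]
* T. Koma, H. Tasaki, J. Stat. Phys. 76 (1994) 745, §1 (symmetry-breaking source). [cite: KomaTasaki1994, §1]
-/

noncomputable section

namespace Literature.MathematicalPhysics.QuantumLattice

open Matrix Finset HubbardWave0 Literature.Probability.LatticeModels ThermodynamicLimit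
open _root_.Filter
open scoped _root_.Topology ComplexOrder BigOperators

/-! ### §1. The dressed `K₃` bracket at every filling -/

namespace InfVolFermionState

/-- **DRESSED LOWER `K₃` BRACKET FOR EVERY TRANSLATION-INVARIANT STATE.** For `V ≥ 0` and an all-fillings
`t' = 0` row `ℓ ≤ 0`, `ℓ ≤ e(1, 0, V, ρ)` for every `0 < ρ < 2`: `|s|ℓ ≤ s·K₃(σ) + |s|V·D(σ)` for every
translation-invariant `σ` (at density `0` the pulled-back nearest-neighbour energy vanishes, at density `2` it is
`|s|V ≥ 0`). [cite: Ruelle1969, §3.4] -/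
theorem IsTranslationInvariant.abs_mul_le_tpp_add_of_allFillings {σ : InfVolFermionState 2}
    (hσ : σ.IsTranslationInvariant) (s : ℝ) {V : ℝ} (hV : 0 ≤ V) {ℓ : ℝ} (hℓ0 : ℓ ≤ 0)
    (hℓ : ∀ ρ : ℝ, 0 < ρ → ρ < 2 → ℓ ≤ energyDensityTT' 1 0 V ρ) :
    |s| * ℓ ≤ s * σ.meanEnergy (axialRange2HoppingFermionInteraction 2 1) 2 +
      |s| * V * σ.meanEnergy (hubbardTTPrimeFermionInteraction 0 0 1) 1 := by
  have hsℓ : |s| * ℓ ≤ 0 := mul_nonpos_of_nonneg_of_nonpos (abs_nonneg s) hℓ0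
  have hsV : 0 ≤ |s| * V := mul_nonneg (abs_nonneg s) hV
  rw [← σ.meanEnergy_mapAct_doubling s (|s| * V)]
  have hTI := hσ.mapAct (doubling 2) doubling_injective
  have hρ' : (σ.mapAct (doubling 2) doubling_injective).density = σ.density :=
    σ.density_mapAct (doubling 2) doubling_injective (map_zero _)
  rcases (σ.density_nonneg).eq_or_lt with h0 | h0
  · rw [hubbardTTPrimeFermionInteraction_tPrime_zero,
      show (σ.mapAct (doubling 2) doubling_injective).meanEnergy (hubbardFermionInteraction 2 s (|s| * V)) 1 =
        (σ.mapAct (doubling 2) doubling_injective).hubbardEnergyDensity s (|s| * V) from rfl,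
      hTI.hubbardEnergyDensity_eq_zero_of_density_eq_zero s (|s| * V) (by rw [hρ']; exact h0.symm)]
    exact hsℓ
  rcases (σ.density_le_two).eq_or_lt with h2 | h2
  · rw [hubbardTTPrimeFermionInteraction_tPrime_zero,
      show (σ.mapAct (doubling 2) doubling_injective).meanEnergy (hubbardFermionInteraction 2 s (|s| * V)) 1 =
        (σ.mapAct (doubling 2) doubling_injective).hubbardEnergyDensity s (|s| * V) from rfl,
      hTI.hubbardEnergyDensity_eq_of_density_eq_two s (|s| * V) (by rw [hρ']; exact h2)]
    exact hsℓ.trans hsV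
  · rw [σ.meanEnergy_mapAct_doubling s (|s| * V)]
    have h := hσ.abs_mul_energyDensityTT'_nn_le_tpp_add h0 h2 s hV
    have hℓρ := mul_le_mul_of_nonneg_left (hℓ _ h0 h2) (abs_nonneg s)
    linarith

/-- **The two-sided all-fillings bracket**: `|s|ℓ − |s|V·D(σ) ≤ s·K₃(σ) ≤ |s|V·D(σ) − |s|ℓ` for EVERY
translation-invariant `σ`. [cite: Ruelle1969, §3.4] -/
theorem IsTranslationInvariant.mul_axialRange2Hopping_mem_Icc_of_allFillings {σ : InfVolFermionState 2}
    (hσ : σ.IsTranslationInvariant) (s : ℝ) {V : ℝ} (hV : 0 ≤ V) {ℓ : ℝ} (hℓ0 : ℓ ≤ 0)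
    (hℓ : ∀ ρ : ℝ, 0 < ρ → ρ < 2 → ℓ ≤ energyDensityTT' 1 0 V ρ) :
    s * σ.meanEnergy (axialRange2HoppingFermionInteraction 2 1) 2 ∈
      Set.Icc (|s| * ℓ - |s| * V * σ.meanEnergy (hubbardTTPrimeFermionInteraction 0 0 1) 1)
        (|s| * V * σ.meanEnergy (hubbardTTPrimeFermionInteraction 0 0 1) 1 - |s| * ℓ) := by
  have hlo := hσ.abs_mul_le_tpp_add_of_allFillings s hV hℓ0 hℓ
  have hhi := hσ.abs_mul_le_tpp_add_of_allFillings (-s) hV hℓ0 hℓ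
  rw [abs_neg] at hhi
  constructor <;> linarith

end InfVolFermionState

/-- **An all-fillings row from ONE all-density tangent with non-negative slope**: `a + bρ ≤ e(1, 0, V, ρ)`
for every `0 < ρ < 2` with `b ≥ 0`, `a ≤ 0` gives the all-fillings row `ℓ = a` (the tangent families of the
low-density certified rows, e.g. `(8, ½, 0)`, have `b > 0`). [cite: Ruelle1969, §3.4] -/
theorem allFillingsRow_of_tangent {V a b : ℝ} (hb : 0 ≤ b)
    (hrow : ∀ ρ : ℝ, 0 < ρ → ρ < 2 → a + b * ρ ≤ energyDensityTT' 1 0 V ρ) :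
    ∀ ρ : ℝ, 0 < ρ → ρ < 2 → a ≤ energyDensityTT' 1 0 V ρ :=
  fun ρ h0 h2 => by nlinarith [hrow ρ h0 h2, mul_nonneg hb h0.le]

/-! ### §2. The unconstrained object-M floor -/

/-- **DRESSED UNCONSTRAINED OBJECT-M FLOOR.** For `V ≥ 0` and an all-fillings row `ℓ` (`ℓ ≤ 0`, `ℓ ≤ e(1,0,V,ρ)` on
`(0,2)`): `e₀^{tt'}(t, t', U − |s|V) + |s|ℓ ≤ e₀(t, t', s, U)` — the translation-invariant (all-fillings) densities
at range parameters `1` and `2`. [cite: Ruelle1969, §3.4] -/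
theorem tiGroundEnergyDensity_add_abs_mul_le_tpp (t t' s U : ℝ) {V : ℝ} (hV : 0 ≤ V) {ℓ : ℝ} (hℓ0 : ℓ ≤ 0)
    (hℓ : ∀ ρ : ℝ, 0 < ρ → ρ < 2 → ℓ ≤ energyDensityTT' 1 0 V ρ) :
    (hubbardTTPrimeFermionInteraction t t' (U - |s| * V)).tiGroundEnergyDensity 1 + |s| * ℓ ≤
      (hubbardTT'T''FermionInteraction t t' s U).tiGroundEnergyDensity 2 := by
  refine FermionInteraction.le_tiGroundEnergyDensity _ _ fun σ hσ => ?_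
  rw [σ.meanEnergy_hubbardTT'T''_eq_add_mapAct_doubling t t' s U (|s| * V), σ.meanEnergy_mapAct_doubling]
  have h1 := FermionInteraction.tiGroundEnergyDensity_le_meanEnergy
    (hubbardTTPrimeFermionInteraction t t' (U - |s| * V)) 1 hσ
  have h2 := hσ.abs_mul_le_tpp_add_of_allFillings s hV hℓ0 hℓ
  linarith

/-! ### §3. The pair-sourced object-M floor at every source -/

/-- **`U`-split of the pair-sourced object-M mean energy**: for every state `ω`,
`e^{M,src}_{(t,t',s,U,μ,g,h)}(ω) = e^{src}_{(t,t',U−W,μ,g,h)}(ω) + e_{Φ(s,0,W)}(ω ∘ Γ_{2·})`.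
[cite: KomaTasaki1994, §1] -/
theorem InfVolFermionState.meanEnergy_hubbardTT'T''Sourced_eq_add_mapAct_doubling (ω : InfVolFermionState 2)
    (t t' s U μ : ℝ) (g : Site 2 → ℝ) (h W : ℝ) :
    ω.meanEnergy (hubbardTT'T''SourcedInteraction t t' s U μ g h) 2 =
      ω.meanEnergy (hubbardTTPrimeSourcedInteraction t t' (U - W) μ g h) 1 +
        (ω.mapAct (doubling 2) doubling_injective).meanEnergy (hubbardTTPrimeFermionInteraction s 0 W) 1 := by
  rw [ω.meanEnergy_hubbardTT'T''Sourced t t' s U μ g h, meanEnergy_hubbardTTPrimeSourced t t' (U - W) μ g h ω,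
    ω.meanEnergy_hubbardTT'T''_eq_add_mapAct_doubling t t' s U W]
  ring

/-- **DRESSED PAIR-SOURCED OBJECT-M FLOOR (generic source `g`, any `t`).** For `V ≥ 0` and an all-fillings row `ℓ`:
`e₀(Φ^{src}(t,t',U − |s|V,μ,g,h)) + |s|ℓ ≤ e₀(Φ^{M,src}(t,t',s,U,μ,g,h))`. [cite: KomaTasaki1994, §1] -/
theorem tiGroundEnergyDensity_sourced_add_abs_mul_le_tppSourced (t t' s U μ : ℝ) (g : Site 2 → ℝ) (h : ℝ)
    {V : ℝ} (hV : 0 ≤ V) {ℓ : ℝ} (hℓ0 : ℓ ≤ 0) (hℓ : ∀ ρ : ℝ, 0 < ρ → ρ < 2 → ℓ ≤ energyDensityTT' 1 0 V ρ) :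
    (hubbardTTPrimeSourcedInteraction t t' (U - |s| * V) μ g h).tiGroundEnergyDensity 1 + |s| * ℓ ≤
      (hubbardTT'T''SourcedInteraction t t' s U μ g h).tiGroundEnergyDensity 2 := by
  refine FermionInteraction.le_tiGroundEnergyDensity _ _ fun σ hσ => ?_
  rw [σ.meanEnergy_hubbardTT'T''Sourced_eq_add_mapAct_doubling t t' s U μ g h (|s| * V),
    σ.meanEnergy_mapAct_doubling]
  have h1 := FermionInteraction.tiGroundEnergyDensity_le_meanEnergy
    (hubbardTTPrimeSourcedInteraction t t' (U - |s| * V) μ g h) 1 hσ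
  have h2 := hσ.abs_mul_le_tpp_add_of_allFillings s hV hℓ0 hℓ
  linarith

/-- **DRESSED d-WAVE-SOURCED OBJECT-M FLOOR** (`t = 1`, `g = dWaveFormFactor`): for `V ≥ 0` and an all-fillings row `ℓ`,
`e_src(t', U − |s|V, μ, h) + |s|ℓ ≤ e^M_src(t', s, U, μ, h)` — the replacement of
`tiGroundEnergyDensity_tppSourced_ge_of_le`'s kinematic `−(16/π²)|t''|`. [cite: KomaTasaki1994, §1] -/
theorem dWaveSourceEnergyDensityTT'_add_abs_mul_le_tppSourced (t' s U μ h : ℝ) {V : ℝ} (hV : 0 ≤ V)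
    {ℓ : ℝ} (hℓ0 : ℓ ≤ 0) (hℓ : ∀ ρ : ℝ, 0 < ρ → ρ < 2 → ℓ ≤ energyDensityTT' 1 0 V ρ) :
    dWaveSourceEnergyDensityTT' t' (U - |s| * V) μ h + |s| * ℓ ≤
      (hubbardTT'T''SourcedInteraction 1 t' s U μ dWaveFormFactor h).tiGroundEnergyDensity 2 := by
  rw [dWaveSourceEnergyDensityTT'_eq_tiGroundEnergyDensity]
  exact tiGroundEnergyDensity_sourced_add_abs_mul_le_tppSourced 1 t' s U μ dWaveFormFactor h hV hℓ0 hℓ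

/-- **Fed form with a LOWER-`U` sourced anchor.** The d-wave-sourced density is non-decreasing in `U`
(`dWaveSourceEnergyDensityTT'_mono_U`), so a certified sourced floor `lo ≤ e_src(t', U₀, μ, h)` at ANY
`U₀ ≤ U − |s|V` and an all-fillings row `ℓ` give `lo + |s|ℓ ≤ e^M_src(t', s, U, μ, h)`. [cite: KomaTasaki1994, §1] -/
theorem le_tppSourced_of_sourcedAnchor_diagU (t' s : ℝ) {U U₀ V : ℝ} (hV : 0 ≤ V)
    (hU₀U : U₀ + |s| * V ≤ U) (μ h : ℝ) {lo ℓ : ℝ} (hlo : lo ≤ dWaveSourceEnergyDensityTT' t' U₀ μ h)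
    (hℓ0 : ℓ ≤ 0) (hℓ : ∀ ρ : ℝ, 0 < ρ → ρ < 2 → ℓ ≤ energyDensityTT' 1 0 V ρ) :
    lo + |s| * ℓ ≤ (hubbardTT'T''SourcedInteraction 1 t' s U μ dWaveFormFactor h).tiGroundEnergyDensity 2 := by
  have hmono := dWaveSourceEnergyDensityTT'_mono_U t' μ h (by linarith : U₀ ≤ U - |s| * V)
  have hmain := dWaveSourceEnergyDensityTT'_add_abs_mul_le_tppSourced t' s U μ h hV hℓ0 hℓ
  linarith

/-- **`t''`-interval form**: for `|s| ≤ m`, `U₀ + mV ≤ U`: `lo + m·ℓ ≤ e^M_src(t', s, U, μ, h)`. [cite: KomaTasaki1994, §1] -/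
theorem le_tppSourced_of_sourcedAnchor_diagU_of_abs_le (t' : ℝ) {s m U U₀ V : ℝ} (hsm : |s| ≤ m)
    (hV : 0 ≤ V) (hU₀U : U₀ + m * V ≤ U) (μ h : ℝ) {lo ℓ : ℝ}
    (hlo : lo ≤ dWaveSourceEnergyDensityTT' t' U₀ μ h) (hℓ0 : ℓ ≤ 0)
    (hℓ : ∀ ρ : ℝ, 0 < ρ → ρ < 2 → ℓ ≤ energyDensityTT' 1 0 V ρ) :
    lo + m * ℓ ≤ (hubbardTT'T''SourcedInteraction 1 t' s U μ dWaveFormFactor h).tiGroundEnergyDensity 2 := by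
  have hmV : |s| * V ≤ m * V := mul_le_mul_of_nonneg_right hsm hV
  have hmain := le_tppSourced_of_sourcedAnchor_diagU t' s (U := U) hV (by linarith) μ h hlo hℓ0 hℓ
  have hmℓ : m * ℓ ≤ |s| * ℓ := mul_le_mul_of_nonpos_right hsm hℓ0
  linarith

/-! ### Appendix (2026-08-28, append-only): an all-fillings row from TWO tangents of opposite slope sign

The certified all-density tangent families of the square-lattice Hubbard model at one coupling `V` come with slopes
`μ(ρ₀)` of both signs (negative below the density where `μ = 0`, positive above). ONE tangent with `b ≥ 0` gives the
all-fillings row `a` (`allFillingsRow_of_tangent`), which is poor when `b` is large (e.g. the `7/8` tangent); TWO tangents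
`a₁ + b₁ρ` (`b₁ ≤ 0`) and `a₂ + b₂ρ` (`b₂ ≥ 0`, `b₁ < b₂`) give the value of their upper envelope at the crossing,
`(b₂a₁ − b₁a₂)/(b₂ − b₁)`, as an all-fillings row — the input `ℓ'` of the sourced / unconstrained dressed floors. -/

/-- **All-fillings row from two tangents of opposite slope sign.** If `a₁ + b₁ρ ≤ e(1,0,V,ρ)` and
`a₂ + b₂ρ ≤ e(1,0,V,ρ)` for every `0 < ρ < 2`, with `b₁ ≤ 0 ≤ b₂` and `b₁ < b₂`, then
`(b₂a₁ − b₁a₂)/(b₂ − b₁) ≤ e(1,0,V,ρ)` for every `0 < ρ < 2` (below the crossing the decreasing tangent is above the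
crossing value, above it the increasing one is). [cite: Ruelle1969, §3.4] -/
theorem allFillingsRow_of_two_tangents {V a₁ b₁ a₂ b₂ : ℝ} (hb₁ : b₁ ≤ 0) (hb₂ : 0 ≤ b₂) (hb : b₁ < b₂)
    (h₁ : ∀ ρ : ℝ, 0 < ρ → ρ < 2 → a₁ + b₁ * ρ ≤ energyDensityTT' 1 0 V ρ)
    (h₂ : ∀ ρ : ℝ, 0 < ρ → ρ < 2 → a₂ + b₂ * ρ ≤ energyDensityTT' 1 0 V ρ) :
    ∀ ρ : ℝ, 0 < ρ → ρ < 2 → (b₂ * a₁ - b₁ * a₂) / (b₂ - b₁) ≤ energyDensityTT' 1 0 V ρ := by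
  intro ρ h0 h2
  have hd : 0 < b₂ - b₁ := sub_pos.2 hb
  rw [div_le_iff₀ hd]
  -- the crossing abscissa `ρc = (a₁ − a₂)/(b₂ − b₁)`; compare `ρ` with it through `(b₂ − b₁)ρ` vs `a₁ − a₂`
  rcases le_total ((b₂ - b₁) * ρ) (a₁ - a₂) with hle | hle
  · -- `ρ ≤ ρc`: use the non-increasing tangent `a₁ + b₁ρ ≥ a₁ + b₁ρc`
    have h := mul_le_mul_of_nonneg_left (h₁ ρ h0 h2) hd.le
    nlinarith [mul_le_mul_of_nonpos_left hle hb₁]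
  · -- `ρc ≤ ρ`: use the non-decreasing tangent
    have h := mul_le_mul_of_nonneg_left (h₂ ρ h0 h2) hd.le
    nlinarith [mul_le_mul_of_nonneg_left hle hb₂]

/-- The crossing value is non-positive as soon as one of the two tangents is non-positive at the crossing, e.g. when
`a₁ ≤ 0` and `a₂ ≤ 0` (both intercepts non-positive) — the side condition `ℓ' ≤ 0` of the dressed floors. [cite: Ruelle1969, §3.4] -/
theorem crossing_nonpos_of_intercepts_nonpos {a₁ b₁ a₂ b₂ : ℝ} (hb₁ : b₁ ≤ 0) (hb₂ : 0 ≤ b₂) (hb : b₁ < b₂)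
    (ha₁ : a₁ ≤ 0) (ha₂ : a₂ ≤ 0) : (b₂ * a₁ - b₁ * a₂) / (b₂ - b₁) ≤ 0 := by
  have hd : 0 < b₂ - b₁ := sub_pos.2 hb
  rw [div_le_iff₀ hd, zero_mul]
  nlinarith [mul_nonpos_of_nonneg_of_nonpos hb₂ ha₁, mul_nonneg_of_nonpos_of_nonpos hb₁ ha₂]

end Literature.MathematicalPhysics.QuantumLattice

end
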